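import Literature.Analysis.FluidPDE.OseenSliceHolder
import Literature.Analysis.FluidPDE.OseenSliceHolderSeminorm
import HarnessLib

/-!
# Hölder data gain one derivative under the Oseen slice operator: the two-constant form

Analysis/FluidPDE support file (everything proved; no definitions, no named facts) on the proof
path of the corrected perturbation theorem of M. P. Coiculescu, S. Palasek, Invent. Math. 244
(2025), arXiv:2503.14699, Props. 4.2–4.3 (hypothesis `hB`, `κ ≤ α`, of
`Literature.Barriers.NavierStokesRegularity.CoiculescuPalasek2025_construction_of_parts'`): the
`C^{1,κ}` bound of the correction `w` is read off the mild equation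
`w = 𝒟[F] - 𝒟[2v ⊙ w] - 𝒟[w ⊗ w]` by the heat/Leray estimates of the paper's Lemma 2.2 (2.5),
applied slice by slice to `N_σ[a, b] = e^{σΔ}P∇·(a ⊗ b)` (`oseenSlice`). The tree's
`exists_holder_gain_oseenSlice_zero` (`OseenSliceHolder.lean`) proves the gain
`‖D N_σ[a,b]‖ ≤ Cσ^{-1+α/2}AB`, `‖D²N_σ[a,b]‖ ≤ Cσ^{-3/2+α/2}AB` for `C^{0,α}` data in the
single-constant class `IsHolderField 0 α A a` (`‖a‖ ≤ A` AND `[a]_α ≤ A`). For the weighted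
estimates of Prop. 4.3 the sup norm and the Hölder seminorm of the data scale differently in
time (`‖w(τ)‖_∞ ~ τ^{α-1/2}`, `[w(τ)]_γ ~ τ^{α-1/2-γ/2}`), so the single constant loses a power of
`τ`; this file proves the same gain with the sup bounds `M_a, M_b` and the Hölder constants
`H_a, H_b` kept apart, in the bilinear shape in which the mollification argument produces it:

* `exists_heatExtension_mollify_two` — `‖e^{σΔ}a‖ ≤ M_a`, `‖D e^{σΔ}a‖ ≤ cσ^{-1/2+α/2}H_a`,
  `‖a - e^{σΔ}a‖ ≤ cσ^{α/2}H_a` (the tree's `norm_fderiv_heatExtension_le_of_holder`,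
  `norm_heatExtension_sub_self_le_of_holder`);
* `exists_holder_gain_oseenSlice_two` —
  `‖D N_σ[a,b]‖ ≤ C σ^{-1+α/2}(H_aM_b + M_aH_b)`, `‖D²N_σ[a,b]‖ ≤ C σ^{-3/2+α/2}(H_aM_b + M_aH_b)`
  (split `a = a_σ + (a - a_σ)`, `b = b_σ + (b - b_σ)`; derivatives on the smooth parts, kernel
  bounds `‖DⁱN_σ[f,g]‖ ≤ Cᵢσ^{-(i+1)/2}‖f‖‖g‖` on the small rough parts — the tree's proof, verbatim
  with two constants);
* `exists_holder_fderiv_oseenSlice_sub_le_two` — by interpolation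
  (`norm_sub_le_interpolate_fderiv`), `‖DN_σ[a,b](x) - DN_σ[a,b](x')‖ ≤
  2C σ^{-1+α/2-κ/2}(H_aM_b + M_aH_b)‖x - x'‖^κ` for `0 ≤ κ ≤ 1`: `α`-Hölder data give a `κ`-Hölder
  derivative with the integrable weight `σ^{-1+(α-κ)/2}` when `κ < α`;
* `exists_oseenSlice_sub_le_of_bound` — the kernel form for merely bounded data,
  `‖N_σ[a,b](x) - N_σ[a,b](x')‖ ≤ C σ^{-1/2-γ/2} M_aM_b ‖x - x'‖^γ`, `0 ≤ γ ≤ 1` (interpolation of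
  `‖N_σ‖ ≤ C₀σ^{-1/2}` and `‖DN_σ‖ ≤ C₁σ⁻¹`).

## References

* M. P. Coiculescu, S. Palasek, Invent. Math. 244 (2025) = arXiv:2503.14699, §2.3 Lemma 2.2 (2.5)
  and the proofs of Props. 4.2–4.3. [CoiculescuPalasek2025]
* G. Koch, N. Nadirashvili, G. Seregin, V. Šverák, Acta Math. 203 (2009) = arXiv:0709.3599v1,
  §3 (3.12)–(3.13). [KochNadirashviliSereginSverak2009]
* T. Buckmaster, C. De Lellis, L. Székelyhidi Jr., V. Vicol, CPAM 72 (2019), §2.2 (mollification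
  estimates). [BuckmasterEtAl2018]
-/

noncomputable section

open MeasureTheory Set Function Filter Metric Real
open _root_.Topology
open scoped ENNReal NNReal RealInnerProductSpace ContDiff

namespace Literature.Analysis.FluidPDE

open UnboundedOperators (heatKernel heatExtension)

variable {E : Type*} [NormedAddCommGroup E] [InnerProductSpace ℝ E] [FiniteDimensional ℝ E]
  [MeasurableSpace E] [BorelSpace E]
variable {F : Type*} [NormedAddCommGroup F] [NormedSpace ℝ F]

/-! ### Mollified Hölder data, two constants -/

/-- **Heat mollification of Hölder data, sup bound and Hölder constant kept apart**: there is
`c = c(E)` such that for `0 ≤ α ≤ 1`, `σ > 0` and continuous `a` with `‖a‖ ≤ M` and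
`‖a(y) - a(z)‖ ≤ H‖y - z‖^α`, the caloric extension `a_σ = e^{σΔ}a` is `C¹` with `‖a_σ‖ ≤ M`,
`‖Da_σ‖ ≤ c σ^{-1/2+α/2} H` and `‖a - a_σ‖ ≤ c σ^{α/2} H`. [cite: BuckmasterEtAl2018, §2.2 (standard mollification estimates)] -/
theorem exists_heatExtension_mollify_two [CompleteSpace F] :
    ∃ c : ℝ, 0 ≤ c ∧ ∀ {σ α : ℝ}, 0 < σ → 0 ≤ α → α ≤ 1 → ∀ {a : E → F} {M H : ℝ},
      Continuous a → (∀ y, ‖a y‖ ≤ M) → 0 ≤ H → (∀ y z, ‖a y - a z‖ ≤ H * ‖y - z‖ ^ α) →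
        ContDiff ℝ 1 (heatExtension a σ) ∧ (∀ y, ‖heatExtension a σ y‖ ≤ M) ∧
        (∀ y, ‖fderiv ℝ (heatExtension a σ) y‖ ≤ c * σ ^ (-(1 / 2 : ℝ) + α / 2) * H) ∧
        (∀ y, ‖a y - heatExtension a σ y‖ ≤ c * σ ^ (α / 2) * H) := by
  set d2 : ℝ := (2 : ℝ) ^ ((Module.finrank ℝ E : ℝ) / 2) with hd2
  set cH : ℝ := 1 + 2 * d2 with hcH
  have hd2p : 0 < d2 := by positivity
  have hcHp : 0 < cH := by positivity
  refine ⟨max (d2 * cH * 2) cH, by positivity, fun {σ α} hσ hα0 hα1 {a M H} hcont hbd hH0 hH => ?_⟩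
  refine ⟨UnboundedOperators.contDiff_heatExtension_of_bound hcont hbd hσ,
    fun y => UnboundedOperators.norm_heatExtension_le_of_bound hbd hσ y, fun y => ?_, fun y => ?_⟩
  · have h := UnboundedOperators.norm_fderiv_heatExtension_le_of_holder hcont hbd hH0 hα0 hα1 hH hσ y
    refine h.trans ?_
    have h2σ : (2 * σ) ^ (α / 2) = 2 ^ (α / 2) * σ ^ (α / 2) :=
      Real.mul_rpow zero_le_two hσ.le
    have hexp : σ ^ (-(1 / 2 : ℝ) + α / 2) = σ ^ (-(1 / 2 : ℝ)) * σ ^ (α / 2) := Real.rpow_add hσ _ _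
    rw [h2σ, hexp]
    have h22 := two_rpow_half_le_two hα1
    have hσ1 : 0 ≤ σ ^ (-(1 / 2 : ℝ)) := Real.rpow_nonneg hσ.le _
    have hσ2 : 0 ≤ σ ^ (α / 2) := Real.rpow_nonneg hσ.le _
    calc d2 * σ ^ (-(1 / 2 : ℝ)) * (cH * (2 ^ (α / 2) * σ ^ (α / 2))) * H
        = (d2 * cH * 2 ^ (α / 2)) * (σ ^ (-(1 / 2 : ℝ)) * σ ^ (α / 2)) * H := by ring
      _ ≤ (d2 * cH * 2) * (σ ^ (-(1 / 2 : ℝ)) * σ ^ (α / 2)) * H := by gcongr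
      _ ≤ max (d2 * cH * 2) cH * (σ ^ (-(1 / 2 : ℝ)) * σ ^ (α / 2)) * H := by
          gcongr; exact le_max_left _ _
  · rw [norm_sub_rev]
    refine (UnboundedOperators.norm_heatExtension_sub_self_le_of_holder hcont hbd hH0 hα0 hα1 hH hσ
      y).trans ?_
    have hσ2 : 0 ≤ σ ^ (α / 2) := Real.rpow_nonneg hσ.le _
    calc cH * H * σ ^ (α / 2) = cH * σ ^ (α / 2) * H := by ring
      _ ≤ max (d2 * cH * 2) cH * σ ^ (α / 2) * H := by gcongr; exact le_max_right _ _

/-! ### The gain with two constants -/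

/-- **Hölder data gain one derivative under the slice operator, sup bounds and Hölder constants
kept apart**: there is `C = C(E)` such that for `σ > 0`, `0 ≤ α ≤ 1` and continuous fields `a, b`
with `‖a‖ ≤ M_a`, `‖b‖ ≤ M_b`, `‖a(y) - a(z)‖ ≤ H_a‖y - z‖^α`, `‖b(y) - b(z)‖ ≤ H_b‖y - z‖^α`,

  `‖D N_σ[a, b](x)‖ ≤ C σ^{-1+α/2} (H_aM_b + M_aH_b)`,
  `‖D² N_σ[a, b](x)‖ ≤ C σ^{-3/2+α/2} (H_aM_b + M_aH_b)`.

Proof: the tree's `exists_holder_gain_oseenSlice_zero` with two constants (mollify,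
`N[a,b] = N[a_σ,b_σ] + N[a_σ, b - b_σ] + N[a - a_σ, b]`, derivatives on the smooth parts, kernel
bounds on the rough parts). This is the slice form of Coiculescu–Palasek's (2.5)
`‖e^{sΔ}P∇·G‖_{𝒞^{1}} ≲ s^{-1+α/2}‖G‖_{𝒞^{α}}` for rank-one `G = a ⊗ b`.
[cite: CoiculescuPalasek2025, §2.3 Lemma 2.2 (2.5)] -/
theorem exists_holder_gain_oseenSlice_two :
    ∃ C : ℝ, 0 ≤ C ∧ ∀ {σ α : ℝ}, 0 < σ → 0 ≤ α → α ≤ 1 →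
      ∀ {a b : E → E} {Ma Mb Ha Hb : ℝ}, Continuous a → Continuous b →
      (∀ y, ‖a y‖ ≤ Ma) → (∀ y, ‖b y‖ ≤ Mb) → 0 ≤ Ha → 0 ≤ Hb →
      (∀ y z, ‖a y - a z‖ ≤ Ha * ‖y - z‖ ^ α) → (∀ y z, ‖b y - b z‖ ≤ Hb * ‖y - z‖ ^ α) → ∀ x,
        ‖iteratedFDeriv ℝ 1 (oseenSlice σ a b) x‖ ≤ C * σ ^ (-1 + α / 2) * (Ha * Mb + Ma * Hb) ∧
        ‖iteratedFDeriv ℝ 2 (oseenSlice σ a b) x‖ ≤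
          C * σ ^ (-(3 / 2 : ℝ) + α / 2) * (Ha * Mb + Ma * Hb) := by
  obtain ⟨C₀, hC₀, hN⟩ := exists_norm_oseenSlice_le (E := E)
  obtain ⟨C₁, hC₁, hD1⟩ := exists_norm_iteratedFDeriv_oseenSlice_le (E := E) 1
  obtain ⟨C₂, hC₂, hD2⟩ := exists_norm_iteratedFDeriv_oseenSlice_le (E := E) 2
  obtain ⟨c, hc, hmol⟩ := exists_heatExtension_mollify_two (E := E) (F := E)
  refine ⟨4 * (C₀ + C₁ + C₂) * c, by positivity,
    fun {σ α} hσ hα hα1 {a b Ma Mb Ha Hb} hac hbc hab hbb hHa hHb hHa' hHb' x => ?_⟩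
  have hMa : 0 ≤ Ma := (norm_nonneg _).trans (hab x)
  have hMb : 0 ≤ Mb := (norm_nonneg _).trans (hbb x)
  set S : ℝ := Ha * Mb + Ma * Hb with hS
  have hS0 : 0 ≤ S := by positivity
  have hS1 : Ha * Mb ≤ S := le_add_of_nonneg_right (by positivity)
  have hS2 : Ma * Hb ≤ S := le_add_of_nonneg_left (by positivity)
  -- clean exponents for the first- and second-order slice bounds
  have hD1' : ∀ {a b : E → E} {Ma Mb : ℝ}, Measurable a → Measurable b → (∀ y, ‖a y‖ ≤ Ma) →
      (∀ y, ‖b y‖ ≤ Mb) → ∀ x, ‖iteratedFDeriv ℝ 1 (oseenSlice σ a b) x‖ ≤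
        C₁ * σ ^ (-(1 : ℝ)) * Ma * Mb := fun ham hbm ha hb x => by
    have := hD1 hσ ham hbm ha hb x; convert this using 3; norm_num
  have hD2' : ∀ {a b : E → E} {Ma Mb : ℝ}, Measurable a → Measurable b → (∀ y, ‖a y‖ ≤ Ma) →
      (∀ y, ‖b y‖ ≤ Mb) → ∀ x, ‖iteratedFDeriv ℝ 2 (oseenSlice σ a b) x‖ ≤
        C₂ * σ ^ (-(3 / 2 : ℝ)) * Ma * Mb := fun ham hbm ha hb x => by
    have := hD2 hσ ham hbm ha hb x; convert this using 3; norm_num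
  have hexp1 : σ ^ (-(1 / 2 : ℝ)) * σ ^ (-(1 / 2 : ℝ) + α / 2) = σ ^ (-1 + α / 2) := by
    rw [← Real.rpow_add hσ]; congr 1; ring
  have hexp2 : σ ^ (-(1 : ℝ)) * σ ^ (α / 2) = σ ^ (-1 + α / 2) := by
    rw [← Real.rpow_add hσ]
  have hexp3 : σ ^ (-(1 : ℝ)) * σ ^ (-(1 / 2 : ℝ) + α / 2) = σ ^ (-(3 / 2 : ℝ) + α / 2) := by
    rw [← Real.rpow_add hσ]; congr 1; ring
  have hexp4 : σ ^ (-(3 / 2 : ℝ)) * σ ^ (α / 2) = σ ^ (-(3 / 2 : ℝ) + α / 2) := by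
    rw [← Real.rpow_add hσ]
  have hX1 : 0 ≤ σ ^ (-1 + α / 2) := Real.rpow_nonneg hσ.le _
  have hX2 : 0 ≤ σ ^ (-(3 / 2 : ℝ) + α / 2) := Real.rpow_nonneg hσ.le _
  -- mollified data
  obtain ⟨haε1, haεb, hDaε, hga⟩ := hmol hσ hα hα1 hac hab hHa hHa'
  obtain ⟨hbε1, hbεb, hDbε, hkb⟩ := hmol hσ hα hα1 hbc hbb hHb hHb'
  set aε : E → E := heatExtension a σ with haε_def
  set bε : E → E := heatExtension b σ with hbε_def
  set g : E → E := fun y => a y - aε y with hg_def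
  set kk : E → E := fun y => b y - bε y with hkk_def
  have ham : Measurable a := hac.measurable
  have hbm : Measurable b := hbc.measurable
  have haεm : Measurable aε := haε1.continuous.measurable
  have hbεm : Measurable bε := hbε1.continuous.measurable
  have hgm : Measurable g := ham.sub haεm
  have hkkm : Measurable kk := hbm.sub hbεm
  -- the decomposition `N[a,b] = N[aε,bε] + (N[aε,kk] + N[g,b])`
  have hsplit : oseenSlice σ a b = oseenSlice σ aε bε + (oseenSlice σ aε kk + oseenSlice σ g b) := by
    funext y
    have e1 : a = aε + g := by funext z; simp [hg_def]
    have e2 : b = bε + kk := by funext z; simp [hkk_def]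
    have i1 := integrable_oseenKernel_slice_of_bound hσ haεm.aestronglyMeasurable
      hbm.aestronglyMeasurable haεb hbb y
    have i2 := integrable_oseenKernel_slice_of_bound hσ hgm.aestronglyMeasurable
      hbm.aestronglyMeasurable hga hbb y
    have i3 := integrable_oseenKernel_slice_of_bound hσ haεm.aestronglyMeasurable
      hbεm.aestronglyMeasurable haεb hbεb y
    have i4 := integrable_oseenKernel_slice_of_bound hσ haεm.aestronglyMeasurable
      hkkm.aestronglyMeasurable haεb hkb y
    simp only [Pi.add_apply]
    conv_lhs => rw [e1]
    rw [oseenSlice_add_left i1 i2,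
      show oseenSlice σ aε b y = oseenSlice σ aε bε y + oseenSlice σ aε kk y by
        conv_lhs => rw [e2]
        exact oseenSlice_add_right i3 i4]
    abel
  -- smoothness of the three pieces
  have hs1 : ContDiff ℝ 2 (oseenSlice σ aε bε) := contDiff_oseenSlice hσ haεm hbεm haεb hbεb
  have hs2 : ContDiff ℝ 2 (oseenSlice σ aε kk) := contDiff_oseenSlice hσ haεm hkkm haεb hkb
  have hs3 : ContDiff ℝ 2 (oseenSlice σ g b) := contDiff_oseenSlice hσ hgm hbm hga hbb
  have hs23 : ContDiff ℝ 2 (oseenSlice σ aε kk + oseenSlice σ g b) := hs2.add hs3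
  have hsum : ∀ i ≤ 2, ‖iteratedFDeriv ℝ i (oseenSlice σ a b) x‖ ≤
      ‖iteratedFDeriv ℝ i (oseenSlice σ aε bε) x‖ + (‖iteratedFDeriv ℝ i (oseenSlice σ aε kk) x‖ +
        ‖iteratedFDeriv ℝ i (oseenSlice σ g b) x‖) := by
    intro i hi
    have hi' : (i : WithTop ℕ∞) ≤ 2 := by exact_mod_cast hi
    rw [hsplit, iteratedFDeriv_add_apply (hs1.of_le hi').contDiffAt (hs23.of_le hi').contDiffAt,
      iteratedFDeriv_add_apply (hs2.of_le hi').contDiffAt (hs3.of_le hi').contDiffAt]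
    exact (norm_add_le _ _).trans (add_le_add le_rfl (norm_add_le _ _))
  -- directional derivatives of the mollified data
  have hdir : ∀ v, (Measurable fun y => fderiv ℝ aε y v) ∧ (Measurable fun y => fderiv ℝ bε y v) ∧
      (∀ y, ‖fderiv ℝ aε y v‖ ≤ c * σ ^ (-(1 / 2 : ℝ) + α / 2) * Ha * ‖v‖) ∧
      (∀ y, ‖fderiv ℝ bε y v‖ ≤ c * σ ^ (-(1 / 2 : ℝ) + α / 2) * Hb * ‖v‖) := fun v =>
    ⟨((haε1.continuous_fderiv one_ne_zero).clm_apply continuous_const).measurable,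
      ((hbε1.continuous_fderiv one_ne_zero).clm_apply continuous_const).measurable,
      fun y => (ContinuousLinearMap.le_opNorm _ _).trans
        (mul_le_mul_of_nonneg_right (hDaε y) (norm_nonneg _)),
      fun y => (ContinuousLinearMap.le_opNorm _ _).trans
        (mul_le_mul_of_nonneg_right (hDbε y) (norm_nonneg _))⟩
  have hK : 0 ≤ C₀ + C₁ + C₂ := by positivity
  constructor
  · -- first order
    have hT1 : ‖iteratedFDeriv ℝ 1 (oseenSlice σ aε bε) x‖ ≤ C₀ * c * (σ ^ (-1 + α / 2) * S) := by
      rw [norm_iteratedFDeriv_one]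
      refine ContinuousLinearMap.opNorm_le_bound _ (by positivity) fun v => ?_
      obtain ⟨-, -, hav, hbv⟩ := hdir v
      rw [fderiv_oseenSlice_apply_of_contDiff hσ haε1 hbε1 haεb hbεb hDaε hDbε x v]
      refine (norm_add_le _ _).trans ?_
      calc ‖oseenSlice σ (fun y => fderiv ℝ aε y v) bε x‖ +
            ‖oseenSlice σ aε (fun y => fderiv ℝ bε y v) x‖
          ≤ C₀ * σ ^ (-(1 / 2 : ℝ)) * (c * σ ^ (-(1 / 2 : ℝ) + α / 2) * Ha * ‖v‖) * Mb +
            C₀ * σ ^ (-(1 / 2 : ℝ)) * Ma * (c * σ ^ (-(1 / 2 : ℝ) + α / 2) * Hb * ‖v‖) :=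
            add_le_add (hN hσ hav hbεb x) (hN hσ haεb hbv x)
        _ = C₀ * c * ((σ ^ (-(1 / 2 : ℝ)) * σ ^ (-(1 / 2 : ℝ) + α / 2)) * S) * ‖v‖ := by
            simp only [hS]; ring
        _ = C₀ * c * (σ ^ (-1 + α / 2) * S) * ‖v‖ := by rw [hexp1]
    have hT2 : ‖iteratedFDeriv ℝ 1 (oseenSlice σ aε kk) x‖ ≤ C₁ * c * (σ ^ (-1 + α / 2) * S) := by
      calc ‖iteratedFDeriv ℝ 1 (oseenSlice σ aε kk) x‖
          ≤ C₁ * σ ^ (-(1 : ℝ)) * Ma * (c * σ ^ (α / 2) * Hb) := hD1' haεm hkkm haεb hkb x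
        _ = C₁ * c * ((σ ^ (-(1 : ℝ)) * σ ^ (α / 2)) * (Ma * Hb)) := by ring
        _ = C₁ * c * (σ ^ (-1 + α / 2) * (Ma * Hb)) := by rw [hexp2]
        _ ≤ C₁ * c * (σ ^ (-1 + α / 2) * S) := by gcongr
    have hT3 : ‖iteratedFDeriv ℝ 1 (oseenSlice σ g b) x‖ ≤ C₁ * c * (σ ^ (-1 + α / 2) * S) := by
      calc ‖iteratedFDeriv ℝ 1 (oseenSlice σ g b) x‖
          ≤ C₁ * σ ^ (-(1 : ℝ)) * (c * σ ^ (α / 2) * Ha) * Mb := hD1' hgm hbm hga hbb x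
        _ = C₁ * c * ((σ ^ (-(1 : ℝ)) * σ ^ (α / 2)) * (Ha * Mb)) := by ring
        _ = C₁ * c * (σ ^ (-1 + α / 2) * (Ha * Mb)) := by rw [hexp2]
        _ ≤ C₁ * c * (σ ^ (-1 + α / 2) * S) := by gcongr
    have hY : 0 ≤ σ ^ (-1 + α / 2) * S := by positivity
    calc ‖iteratedFDeriv ℝ 1 (oseenSlice σ a b) x‖
        ≤ C₀ * c * (σ ^ (-1 + α / 2) * S) + (C₁ * c * (σ ^ (-1 + α / 2) * S) +
            C₁ * c * (σ ^ (-1 + α / 2) * S)) := (hsum 1 (by norm_num)).trans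
              (add_le_add hT1 (add_le_add hT2 hT3))
      _ = (C₀ + 2 * C₁) * c * (σ ^ (-1 + α / 2) * S) := by ring
      _ ≤ 4 * (C₀ + C₁ + C₂) * c * (σ ^ (-1 + α / 2) * S) := by
          gcongr; nlinarith
      _ = 4 * (C₀ + C₁ + C₂) * c * σ ^ (-1 + α / 2) * S := by ring
  · -- second order
    have hT1 : ‖iteratedFDeriv ℝ 2 (oseenSlice σ aε bε) x‖ ≤
        C₁ * c * (σ ^ (-(3 / 2 : ℝ) + α / 2) * S) := by
      refine norm_iteratedFDeriv_succ_le_of_forall_fderiv_apply hs1 (by positivity) fun v => ?_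
      obtain ⟨havm, hbvm, hav, hbv⟩ := hdir v
      have hfun : (fun y => fderiv ℝ (oseenSlice σ aε bε) y v) =
          oseenSlice σ (fun y => fderiv ℝ aε y v) bε + oseenSlice σ aε (fun y => fderiv ℝ bε y v) := by
        funext y
        exact fderiv_oseenSlice_apply_of_contDiff hσ haε1 hbε1 haεb hbεb hDaε hDbε y v
      have hc1 : ContDiff ℝ 1 (oseenSlice σ (fun y => fderiv ℝ aε y v) bε) :=
        contDiff_oseenSlice hσ havm hbεm hav hbεb
      have hc2 : ContDiff ℝ 1 (oseenSlice σ aε fun y => fderiv ℝ bε y v) :=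
        contDiff_oseenSlice hσ haεm hbvm haεb hbv
      rw [hfun, iteratedFDeriv_add_apply hc1.contDiffAt hc2.contDiffAt]
      refine (norm_add_le _ _).trans ?_
      calc ‖iteratedFDeriv ℝ 1 (oseenSlice σ (fun y => fderiv ℝ aε y v) bε) x‖ +
            ‖iteratedFDeriv ℝ 1 (oseenSlice σ aε fun y => fderiv ℝ bε y v) x‖
          ≤ C₁ * σ ^ (-(1 : ℝ)) * (c * σ ^ (-(1 / 2 : ℝ) + α / 2) * Ha * ‖v‖) * Mb +
            C₁ * σ ^ (-(1 : ℝ)) * Ma * (c * σ ^ (-(1 / 2 : ℝ) + α / 2) * Hb * ‖v‖) :=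
            add_le_add (hD1' havm hbεm hav hbεb x) (hD1' haεm hbvm haεb hbv x)
        _ = C₁ * c * ((σ ^ (-(1 : ℝ)) * σ ^ (-(1 / 2 : ℝ) + α / 2)) * S) * ‖v‖ := by
            simp only [hS]; ring
        _ = C₁ * c * (σ ^ (-(3 / 2 : ℝ) + α / 2) * S) * ‖v‖ := by rw [hexp3]
    have hT2 : ‖iteratedFDeriv ℝ 2 (oseenSlice σ aε kk) x‖ ≤
        C₂ * c * (σ ^ (-(3 / 2 : ℝ) + α / 2) * S) := by
      calc ‖iteratedFDeriv ℝ 2 (oseenSlice σ aε kk) x‖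
          ≤ C₂ * σ ^ (-(3 / 2 : ℝ)) * Ma * (c * σ ^ (α / 2) * Hb) := hD2' haεm hkkm haεb hkb x
        _ = C₂ * c * ((σ ^ (-(3 / 2 : ℝ)) * σ ^ (α / 2)) * (Ma * Hb)) := by ring
        _ = C₂ * c * (σ ^ (-(3 / 2 : ℝ) + α / 2) * (Ma * Hb)) := by rw [hexp4]
        _ ≤ C₂ * c * (σ ^ (-(3 / 2 : ℝ) + α / 2) * S) := by gcongr
    have hT3 : ‖iteratedFDeriv ℝ 2 (oseenSlice σ g b) x‖ ≤
        C₂ * c * (σ ^ (-(3 / 2 : ℝ) + α / 2) * S) := by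
      calc ‖iteratedFDeriv ℝ 2 (oseenSlice σ g b) x‖
          ≤ C₂ * σ ^ (-(3 / 2 : ℝ)) * (c * σ ^ (α / 2) * Ha) * Mb := hD2' hgm hbm hga hbb x
        _ = C₂ * c * ((σ ^ (-(3 / 2 : ℝ)) * σ ^ (α / 2)) * (Ha * Mb)) := by ring
        _ = C₂ * c * (σ ^ (-(3 / 2 : ℝ) + α / 2) * (Ha * Mb)) := by rw [hexp4]
        _ ≤ C₂ * c * (σ ^ (-(3 / 2 : ℝ) + α / 2) * S) := by gcongr
    have hY : 0 ≤ σ ^ (-(3 / 2 : ℝ) + α / 2) * S := by positivity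
    calc ‖iteratedFDeriv ℝ 2 (oseenSlice σ a b) x‖
        ≤ C₁ * c * (σ ^ (-(3 / 2 : ℝ) + α / 2) * S) +
            (C₂ * c * (σ ^ (-(3 / 2 : ℝ) + α / 2) * S) +
              C₂ * c * (σ ^ (-(3 / 2 : ℝ) + α / 2) * S)) := (hsum 2 le_rfl).trans
              (add_le_add hT1 (add_le_add hT2 hT3))
      _ = (C₁ + 2 * C₂) * c * (σ ^ (-(3 / 2 : ℝ) + α / 2) * S) := by ring
      _ ≤ 4 * (C₀ + C₁ + C₂) * c * (σ ^ (-(3 / 2 : ℝ) + α / 2) * S) := by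
          gcongr; nlinarith
      _ = 4 * (C₀ + C₁ + C₂) * c * σ ^ (-(3 / 2 : ℝ) + α / 2) * S := by ring

/-! ### Interpolated Hölder moduli -/

/-- **`α`-Hölder data give a `κ`-Hölder derivative with weight `σ^{-1+α/2-κ/2}`**: with the
constant `C` of `exists_holder_gain_oseenSlice_two`, for `0 ≤ κ ≤ 1`,
`‖DN_σ[a,b](x) - DN_σ[a,b](x')‖ ≤ 2C σ^{-1+α/2-κ/2}(H_aM_b + M_aH_b)‖x - x'‖^κ` (interpolation
between the first- and second-order gains). The weight is integrable at `σ = 0` iff `κ < α`: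
this is how the `𝒞^{1,κ}` bound of Prop. 4.3 is read off the mild equation near `t' = t`.
[cite: CoiculescuPalasek2025, §2.3 Lemma 2.2 (2.5) and the proof of Prop. 4.2 (term III)] -/
theorem exists_holder_fderiv_oseenSlice_sub_le_two :
    ∃ C : ℝ, 0 ≤ C ∧ ∀ {σ α κ : ℝ}, 0 < σ → 0 ≤ α → α ≤ 1 → 0 ≤ κ → κ ≤ 1 →
      ∀ {a b : E → E} {Ma Mb Ha Hb : ℝ}, Continuous a → Continuous b →
      (∀ y, ‖a y‖ ≤ Ma) → (∀ y, ‖b y‖ ≤ Mb) → 0 ≤ Ha → 0 ≤ Hb →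
      (∀ y z, ‖a y - a z‖ ≤ Ha * ‖y - z‖ ^ α) → (∀ y z, ‖b y - b z‖ ≤ Hb * ‖y - z‖ ^ α) →
      (∀ x, ‖fderiv ℝ (oseenSlice σ a b) x‖ ≤ C * σ ^ (-1 + α / 2) * (Ha * Mb + Ma * Hb)) ∧
      ∀ x x', ‖fderiv ℝ (oseenSlice σ a b) x - fderiv ℝ (oseenSlice σ a b) x'‖ ≤
          2 * C * σ ^ (-1 + α / 2 - κ / 2) * (Ha * Mb + Ma * Hb) * ‖x - x'‖ ^ κ := by
  obtain ⟨C, hC, hG⟩ := exists_holder_gain_oseenSlice_two (E := E)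
  refine ⟨C, hC, fun {σ α κ} hσ hα hα1 hκ0 hκ1 {a b Ma Mb Ha Hb} hac hbc hab hbb hHa hHb hHa' hHb' =>
    ?_⟩
  have hMa : 0 ≤ Ma := (norm_nonneg _).trans (hab 0)
  have hMb : 0 ≤ Mb := (norm_nonneg _).trans (hbb 0)
  set S : ℝ := Ha * Mb + Ma * Hb with hS
  have hS0 : 0 ≤ S := by positivity
  have hsm : ContDiff ℝ 2 (oseenSlice σ a b) :=
    contDiff_oseenSlice hσ hac.measurable hbc.measurable hab hbb
  have hdf : Differentiable ℝ (fderiv ℝ (oseenSlice σ a b)) :=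
    (hsm.fderiv_right (m := 1) (by norm_num)).differentiable one_ne_zero
  have hb1 : ∀ y, ‖fderiv ℝ (oseenSlice σ a b) y‖ ≤ C * σ ^ (-1 + α / 2) * S := fun y => by
    have h := (hG hσ hα hα1 hac hbc hab hbb hHa hHb hHa' hHb' y).1
    rwa [norm_iteratedFDeriv_one] at h
  have hb2 : ∀ y, ‖fderiv ℝ (fderiv ℝ (oseenSlice σ a b)) y‖ ≤ C * σ ^ (-(3 / 2 : ℝ) + α / 2) * S :=
    fun y => by
    have h := (hG hσ hα hα1 hac hbc hab hbb hHa hHb hHa' hHb' y).2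
    rwa [← norm_iteratedFDeriv_fderiv, norm_iteratedFDeriv_one] at h
  refine ⟨hb1, fun x x' => ?_⟩
  have key := norm_sub_le_interpolate_fderiv (f := fderiv ℝ (oseenSlice σ a b)) hκ0 hκ1 hdf hb1 hb2 x x'
  refine key.trans (le_of_eq ?_)
  -- `2 (Cσ^{-1+α/2}S)^{1-κ} (Cσ^{-3/2+α/2}S)^κ = 2Cσ^{-1+α/2-κ/2}S`
  have h1 : (C * σ ^ (-1 + α / 2) * S) ^ (1 - κ) * (C * σ ^ (-(3 / 2 : ℝ) + α / 2) * S) ^ κ =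
      C * σ ^ (-1 + α / 2 - κ / 2) * S := by
    rw [Real.mul_rpow (by positivity) hS0, Real.mul_rpow hC (Real.rpow_nonneg hσ.le _),
      Real.mul_rpow (by positivity) hS0, Real.mul_rpow hC (Real.rpow_nonneg hσ.le _),
      ← Real.rpow_mul hσ.le, ← Real.rpow_mul hσ.le]
    have eC : C ^ (1 - κ) * C ^ κ = C := by
      rw [← Real.rpow_add' hC (by ring_nf; norm_num)]; ring_nf; exact Real.rpow_one C
    have eS : S ^ (1 - κ) * S ^ κ = S := by
      rw [← Real.rpow_add' hS0 (by ring_nf; norm_num)]; ring_nf; exact Real.rpow_one S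
    have eσ : σ ^ ((-1 + α / 2) * (1 - κ)) * σ ^ ((-(3 / 2 : ℝ) + α / 2) * κ) =
        σ ^ (-1 + α / 2 - κ / 2) := by
      rw [← Real.rpow_add hσ]; congr 1; ring
    calc C ^ (1 - κ) * (σ ^ ((-1 + α / 2) * (1 - κ))) * S ^ (1 - κ) *
          (C ^ κ * σ ^ ((-(3 / 2 : ℝ) + α / 2) * κ) * S ^ κ)
        = (C ^ (1 - κ) * C ^ κ) * (σ ^ ((-1 + α / 2) * (1 - κ)) * σ ^ ((-(3 / 2 : ℝ) + α / 2) * κ)) *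
            (S ^ (1 - κ) * S ^ κ) := by ring
      _ = C * σ ^ (-1 + α / 2 - κ / 2) * S := by rw [eC, eS, eσ]
  calc 2 * (C * σ ^ (-1 + α / 2) * S) ^ (1 - κ) * (C * σ ^ (-(3 / 2 : ℝ) + α / 2) * S) ^ κ *
        ‖x - x'‖ ^ κ
      = 2 * ((C * σ ^ (-1 + α / 2) * S) ^ (1 - κ) * (C * σ ^ (-(3 / 2 : ℝ) + α / 2) * S) ^ κ) *
          ‖x - x'‖ ^ κ := by ring
    _ = _ := by rw [h1]; ring

/-- **Kernel form of the Hölder modulus of the slice for merely bounded data**: there is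
`C = C(E)` with `‖N_σ[a,b](x) - N_σ[a,b](x')‖ ≤ C σ^{-1/2-γ/2} M_aM_b ‖x - x'‖^γ` for `σ > 0`,
`0 ≤ γ ≤ 1` and bounded measurable `a, b` (interpolation of the tree's `‖N_σ‖ ≤ C₀σ^{-1/2}M_aM_b` and
`‖DN_σ‖ ≤ C₁σ⁻¹M_aM_b`). The slice form of the paper's `‖e^{sΔ}P∇·G‖_{𝒞^γ} ≲ s^{-1/2-γ/2}‖G‖_{L^∞}`.
[cite: CoiculescuPalasek2025, §2.3 Lemma 2.2 (2.5)] -/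
theorem exists_oseenSlice_sub_le_of_bound :
    ∃ C : ℝ, 0 ≤ C ∧ ∀ {σ γ : ℝ}, 0 < σ → 0 ≤ γ → γ ≤ 1 → ∀ {a b : E → E} {Ma Mb : ℝ},
      Measurable a → Measurable b → (∀ y, ‖a y‖ ≤ Ma) → (∀ y, ‖b y‖ ≤ Mb) → ∀ x x',
        ‖oseenSlice σ a b x - oseenSlice σ a b x'‖ ≤
          C * σ ^ (-(1 / 2 : ℝ) - γ / 2) * Ma * Mb * ‖x - x'‖ ^ γ := by
  obtain ⟨C₀, hC₀, hN⟩ := exists_norm_oseenSlice_le (E := E)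
  obtain ⟨C₁, hC₁, hD1⟩ := exists_norm_iteratedFDeriv_oseenSlice_le (E := E) 1
  set K : ℝ := max C₀ C₁ with hK
  have hK0 : 0 ≤ K := le_max_of_le_left hC₀.le
  refine ⟨2 * K, by positivity, fun {σ γ} hσ hγ0 hγ1 {a b Ma Mb} ham hbm ha hb x x' => ?_⟩
  have hMa : 0 ≤ Ma := (norm_nonneg _).trans (ha x)
  have hMb : 0 ≤ Mb := (norm_nonneg _).trans (hb x)
  set P : ℝ := Ma * Mb with hP
  have hP0 : 0 ≤ P := mul_nonneg hMa hMb
  have hsm : ContDiff ℝ 1 (oseenSlice σ a b) := contDiff_oseenSlice hσ ham hbm ha hb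
  have hdf : Differentiable ℝ (oseenSlice σ a b) := hsm.differentiable one_ne_zero
  have hb0 : ∀ y, ‖oseenSlice σ a b y‖ ≤ K * σ ^ (-(1 / 2 : ℝ)) * P := fun y => by
    calc ‖oseenSlice σ a b y‖ ≤ C₀ * σ ^ (-(1 / 2 : ℝ)) * Ma * Mb := hN hσ ha hb y
      _ = C₀ * (σ ^ (-(1 / 2 : ℝ)) * P) := by rw [hP]; ring
      _ ≤ K * (σ ^ (-(1 / 2 : ℝ)) * P) :=
          mul_le_mul_of_nonneg_right (le_max_left _ _) (by positivity)
      _ = K * σ ^ (-(1 / 2 : ℝ)) * P := by ring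
  have hb1 : ∀ y, ‖fderiv ℝ (oseenSlice σ a b) y‖ ≤ K * σ ^ (-(1 : ℝ)) * P := fun y => by
    have h := hD1 hσ ham hbm ha hb y
    rw [norm_iteratedFDeriv_one] at h
    have he : (-((1 : ℕ) + 1 : ℝ) / 2) = -(1 : ℝ) := by norm_num
    rw [he] at h
    calc ‖fderiv ℝ (oseenSlice σ a b) y‖ ≤ C₁ * σ ^ (-(1 : ℝ)) * Ma * Mb := h
      _ = C₁ * (σ ^ (-(1 : ℝ)) * P) := by rw [hP]; ring
      _ ≤ K * (σ ^ (-(1 : ℝ)) * P) :=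
          mul_le_mul_of_nonneg_right (le_max_right _ _) (by positivity)
      _ = K * σ ^ (-(1 : ℝ)) * P := by ring
  have key := norm_sub_le_interpolate_fderiv (f := oseenSlice σ a b) hγ0 hγ1 hdf hb0 hb1 x x'
  refine key.trans (le_of_eq ?_)
  have h1 : (K * σ ^ (-(1 / 2 : ℝ)) * P) ^ (1 - γ) * (K * σ ^ (-(1 : ℝ)) * P) ^ γ =
      K * σ ^ (-(1 / 2 : ℝ) - γ / 2) * P := by
    rw [Real.mul_rpow (by positivity) hP0, Real.mul_rpow hK0 (Real.rpow_nonneg hσ.le _),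
      Real.mul_rpow (by positivity) hP0, Real.mul_rpow hK0 (Real.rpow_nonneg hσ.le _),
      ← Real.rpow_mul hσ.le, ← Real.rpow_mul hσ.le]
    have eC : K ^ (1 - γ) * K ^ γ = K := by
      rw [← Real.rpow_add' hK0 (by ring_nf; norm_num)]; ring_nf; exact Real.rpow_one K
    have eS : P ^ (1 - γ) * P ^ γ = P := by
      rw [← Real.rpow_add' hP0 (by ring_nf; norm_num)]; ring_nf; exact Real.rpow_one P
    have eσ : σ ^ (-(1 / 2 : ℝ) * (1 - γ)) * σ ^ (-(1 : ℝ) * γ) = σ ^ (-(1 / 2 : ℝ) - γ / 2) := by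
      rw [← Real.rpow_add hσ]; congr 1; ring
    calc K ^ (1 - γ) * (σ ^ (-(1 / 2 : ℝ) * (1 - γ))) * P ^ (1 - γ) *
          (K ^ γ * σ ^ (-(1 : ℝ) * γ) * P ^ γ)
        = (K ^ (1 - γ) * K ^ γ) * (σ ^ (-(1 / 2 : ℝ) * (1 - γ)) * σ ^ (-(1 : ℝ) * γ)) *
            (P ^ (1 - γ) * P ^ γ) := by ring
      _ = K * σ ^ (-(1 / 2 : ℝ) - γ / 2) * P := by rw [eC, eS, eσ]
  calc 2 * (K * σ ^ (-(1 / 2 : ℝ)) * P) ^ (1 - γ) * (K * σ ^ (-(1 : ℝ)) * P) ^ γ * ‖x - x'‖ ^ γ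
      = 2 * ((K * σ ^ (-(1 / 2 : ℝ)) * P) ^ (1 - γ) * (K * σ ^ (-(1 : ℝ)) * P) ^ γ) *
          ‖x - x'‖ ^ γ := by ring
    _ = _ := by rw [h1, hP]; ring

end Literature.Analysis.FluidPDE
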